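import Summits.KontsevichZagierPeriods.KontsevichZagierPeriods.Theorems.K2SymbolChainsJensenIsScissorsBand
import Summits.KontsevichZagierPeriods.KontsevichZagierPeriods.Theorems.K2SymbolChainsJensenIsScissorsLastCoord

/-!
# `FigureEightIsTwoSmyth`: the general product rule `log (V W) ~ log V + log W` for signed unfoldings

Helper for item stmt-KontsevichZagierPeriods-5203 (route K2SymbolChains). Write `L(T, G, W)` for the
signed unfolding `[{(b, u) | b ∈ T, u between 1 and W b}, ±G(b)/u]` of `G · log W` over a base `T`
(`KZ.logUnfoldDomain`, `KZ.logUnfoldIntegrand`). The dilation lemma of the JensenIsScissors toolkit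
(`of_logUnfold_mul_sub_sub_mem`, file `…JensenIsScissorsKLemma`) proves
`[L(K V)] − [L(K)] − [L(V)] ∈ S` under `K ≥ 1`, `K V ≥ 1`. The Jensen step of the figure-eight
side needs the rule for the factorisation `F² = |e(s) − L₊|² · |e(s) − L₋|²` of the item's fibre
bound, where NEITHER factor is `≥ 1`; this file proves the general form

  `[L(T, G, V W)] − [L(T, G, V)] − [L(T, G, W)] ∈ S`    (`of_logUnfold_prod_sub_sub_mem`)

for `V, W > 0` `ℚ`-semialgebraic on `T`, `V` differentiable at the points of `T`, and any subgroup
`S` containing the three scissors move sets. Proof: over `{W ≥ 1}` the signed Chasles relation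
`[L(VW)] − [L(V)] − [band(V, VW)] ∈ S` (`of_logUnfold_sub_sub_band_mem`) and the dilation
`u ↦ V(b) u` carrying `L(W) = [(1, W), G/u]` onto the band (rule 2, `exists_image_lastCoord`);
over `{W < 1}` Chasles for `VW ≤ V` and the dilation carrying the negative sheet `[(W, 1), −G/u]`
onto `[(VW, V), −G/u]`, which cancels the band (`[σ, f] + [σ, −f] ∈ S`). No Newton–Leibniz move.
[Kontsevich–Zagier 2001, §1.1–1.2, rules 1)–2)] [folklore]
-/

noncomputable section

open MeasureTheory Set
open Literature.NumberTheory.Transcendental Literature.ModelTheory.ExponentialFields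
open Summit.KontsevichZagierPeriods.K2SymbolChains.JensenIsScissorsProof

-- single-conjunct summit: Sub = Summit, so the namespace segment repeats by design (CONVENTIONS §2)
set_option linter.dupNamespace false

namespace Summit.KontsevichZagierPeriods.KontsevichZagierPeriods.Theorems

open Literature.NumberTheory.Transcendental.KZ

variable {m : ℕ} {S : AddSubgroup FormalRep}

/-- **The dilated image of one sheet.** For `V > 0` differentiable at the points of `T` and an open
band representation `r = [{(b,u) | b ∈ T, p b < u < q b}, ε·G(b)/u]` with `0 < p ≤ q` (`ε = ±1` a
rational constant), the fibrewise dilation `u ↦ V(b)·u` produces a representation on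
`{V p < u < V q}` with integrand `ε·G/u`, differing from `r` by an element of `S` (rule 2; the
integrand `G/u` is dilation invariant). [Kontsevich–Zagier 2001, §1.2, rule 2)] [folklore] -/
theorem exists_dilate_oband (hS : domainAddRel ∪ integrandAddRel ∪ changeOfVariablesRel ⊆ S)
    {T : Set (Fin m → ℝ)} {G V p q : (Fin m → ℝ) → ℝ} (ε : ℚ) (hT : IsSemialgebraic ℚ T)
    (hG : IsSemialgebraicFunOn ℚ T G) (hV : IsSemialgebraicFunOn ℚ T V)
    (hp : IsSemialgebraicFunOn ℚ T p) (hq : IsSemialgebraicFunOn ℚ T q)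
    (hV0 : ∀ b ∈ T, 0 < V b) (hVd : ∀ b ∈ T, DifferentiableAt ℝ V b)
    (hp0 : ∀ b ∈ T, 0 < p b) (hpq : ∀ b ∈ T, p b ≤ q b) (r : IntegralRep (m + 1))
    (hr : r.domain = {z : Fin (m + 1) → ℝ | Fin.init z ∈ T ∧ p (Fin.init z) < z (Fin.last m) ∧
      z (Fin.last m) < q (Fin.init z)})
    (hri : EqOn r.integrand (fun z => (ε : ℝ) * G (Fin.init z) / z (Fin.last m)) r.domain) :
    ∃ r' : IntegralRep (m + 1), r'.domain = {z : Fin (m + 1) → ℝ | Fin.init z ∈ T ∧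
        V (Fin.init z) * p (Fin.init z) < z (Fin.last m) ∧ z (Fin.last m) < V (Fin.init z) * q (Fin.init z)} ∧
      r'.integrand = (fun z => (ε : ℝ) * G (Fin.init z) / z (Fin.last m)) ∧ of r - of r' ∈ S := by
  have hsub : r.domain ⊆ {z | Fin.init z ∈ T} := fun z hz => by rw [hr] at hz; exact hz.1
  have hεG : IsSemialgebraicFunOn ℚ T (fun b => (ε : ℝ) * G b) :=
    IsSemialgebraicFunOn.mul_holds (isSemialgebraicFunOn_ratCast hT ε) hG
  -- the image band and the integrand on it
  have hD' : IsSemialgebraic ℚ {z : Fin (m + 1) → ℝ | Fin.init z ∈ T ∧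
      (fun w : Fin (m + 1) → ℝ => V (Fin.init w) * w (Fin.last m)) (Fin.snoc (Fin.init z) (p (Fin.init z))) <
        z (Fin.last m) ∧ z (Fin.last m) <
      (fun w : Fin (m + 1) → ℝ => V (Fin.init w) * w (Fin.last m)) (Fin.snoc (Fin.init z) (q (Fin.init z)))} := by
    have h := isSemialgebraic_oband (IsSemialgebraicFunOn.mul_holds hV hp) (IsSemialgebraicFunOn.mul_holds hV hq)
    convert h using 2 with z
    simp
  have hf' : IsSemialgebraicFunOn ℚ {z : Fin (m + 1) → ℝ | Fin.init z ∈ T ∧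
      (fun w : Fin (m + 1) → ℝ => V (Fin.init w) * w (Fin.last m)) (Fin.snoc (Fin.init z) (p (Fin.init z))) <
        z (Fin.last m) ∧ z (Fin.last m) <
      (fun w : Fin (m + 1) → ℝ => V (Fin.init w) * w (Fin.last m)) (Fin.snoc (Fin.init z) (q (Fin.init z)))}
      (fun z => (ε : ℝ) * G (Fin.init z) / z (Fin.last m)) := by
    refine IsSemialgebraicFunOn.div (hεG.comp_init.mono (fun z hz => hz.1) hD')
      (isSemialgebraicFunOn_apply hD' (Fin.last m)) fun z hz => ?_
    have h1 : V (Fin.init z) * p (Fin.init z) < z (Fin.last m) := by simpa using hz.2.1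
    exact ((mul_pos (hV0 _ hz.1) (hp0 _ hz.1)).trans h1).ne'
  obtain ⟨r', hd', hi', hrel⟩ := exists_image_lastCoord hS
    (F := fun w => V (Fin.init w) * w (Fin.last m))
    (F' := fun z => fderiv ℝ (fun w : Fin (m + 1) → ℝ => V (Fin.init w) * w (Fin.last m)) z)
    hp hq hpq r hr (isSemialgebraicFunOn_dilation hV r.isSemialgebraic_domain hsub)
    (fun z hz => (differentiableAt_dilation (hVd _ (hsub hz))).hasFDerivAt)
    (fun b _ => (continuous_const.mul continuous_id : Continuous fun t : ℝ => V b * t).continuousOn.congr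
      (fun t _ => by simp))
    (fun b hb => fun s _ t _ hst => by
      simp only [Fin.init_snoc, Fin.snoc_last]
      exact mul_lt_mul_of_pos_left hst (hV0 b hb))
    hf' (fun z hz => by
      have hb : Fin.init z ∈ T := hsub hz
      have hz' := hz
      rw [hr] at hz'
      have hu : 0 < z (Fin.last m) := (hp0 _ hb).trans hz'.2.1
      rw [hri hz, fderiv_dilation_single (hVd _ hb)]
      simp only [Fin.init_snoc, Fin.snoc_last, abs_of_pos (hV0 _ hb)]
      have hVb := (hV0 _ hb).ne'
      field_simp)
  refine ⟨r', ?_, hi', hrel⟩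
  rw [hd']
  ext z
  simp

/-- **Product rule over `{W ≥ 1}`.** For `V > 0` (differentiable at the points of `T`) and
`W ≥ 1`: `[L(VW)] − [L(V)] − [L(W)] ∈ S` — Chasles at `u = V` and the dilation `u ↦ V u` carrying
`(1, W)` onto `(V, VW)`. [Kontsevich–Zagier 2001, §1.2, rules 1)–2)] [folklore] -/
theorem of_logUnfold_prod_sub_sub_mem_of_one_le
    (hS : domainAddRel ∪ integrandAddRel ∪ changeOfVariablesRel ⊆ S)
    {T : Set (Fin m → ℝ)} {G V W : (Fin m → ℝ) → ℝ} (hT : IsSemialgebraic ℚ T)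
    (hG : IsSemialgebraicFunOn ℚ T G) (hV : IsSemialgebraicFunOn ℚ T V) (hW : IsSemialgebraicFunOn ℚ T W)
    (hV0 : ∀ b ∈ T, 0 < V b) (hW1 : ∀ b ∈ T, 1 ≤ W b) (hVd : ∀ b ∈ T, DifferentiableAt ℝ V b)
    (RVW RV RW : IntegralRep (m + 1))
    (hVWd : RVW.domain = logUnfoldDomain T (fun b => V b * W b))
    (hVWi : EqOn RVW.integrand (logUnfoldIntegrand G) RVW.domain)
    (hVd' : RV.domain = logUnfoldDomain T V) (hVi : EqOn RV.integrand (logUnfoldIntegrand G) RV.domain)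
    (hWd : RW.domain = logUnfoldDomain T W) (hWi : EqOn RW.integrand (logUnfoldIntegrand G) RW.domain) :
    of RVW - of RV - of RW ∈ S := by
  have hc1 : IsSemialgebraicFunOn ℚ T (fun _ => (1 : ℝ)) := by simpa using isSemialgebraicFunOn_ratCast hT 1
  have hVW : IsSemialgebraicFunOn ℚ T (fun b => V b * W b) := IsSemialgebraicFunOn.mul_holds hV hW
  -- the dilated image of `RW = [(1, W), G/u]`
  obtain ⟨RD, hDd, hDi, hrelD⟩ := exists_dilate_oband hS (p := fun _ => (1 : ℝ)) (q := W) 1 hT hG hV hc1 hW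
    hV0 hVd (fun _ _ => one_pos) hW1 RW (by rw [hWd, logUnfoldDomain_eq_of_one_le hW1])
    (fun z hz => by
      have hz' := hz
      rw [hWd, logUnfoldDomain_eq_of_one_le hW1] at hz'
      rw [hWi hz, logUnfoldIntegrand, if_pos hz'.2.1]
      push_cast
      ring)
  -- Chasles at `u = V`
  have hch := of_logUnfold_sub_sub_band_mem hS (G := G) (a := V) (b := fun b => V b * W b) hT hV hVW
    (fun b hb => le_mul_of_one_le_right (hV0 b hb).le (hW1 b hb)) RVW RV RD hVWd hVWi hVd' hVi
    (by rw [hDd]; ext z; simp) (by rw [hDi]; intro z _; push_cast; ring)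
  have : of RVW - of RV - of RW = (of RVW - of RV - of RD) - (of RW - of RD) := by abel
  rw [this]
  exact S.sub_mem hch hrelD

/-- **Product rule over `{W < 1}`.** For `V > 0` (differentiable at the points of `T`) and
`0 < W < 1`: `[L(VW)] − [L(V)] − [L(W)] ∈ S` — Chasles for `VW ≤ V` and the dilation carrying the
negative sheet `[(W, 1), −G/u]` onto `[(VW, V), −G/u]`, which cancels the band.
[Kontsevich–Zagier 2001, §1.2, rules 1)–2)] [folklore] -/
theorem of_logUnfold_prod_sub_sub_mem_of_lt_one
    (hS : domainAddRel ∪ integrandAddRel ∪ changeOfVariablesRel ⊆ S)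
    {T : Set (Fin m → ℝ)} {G V W : (Fin m → ℝ) → ℝ} (hT : IsSemialgebraic ℚ T)
    (hG : IsSemialgebraicFunOn ℚ T G) (hV : IsSemialgebraicFunOn ℚ T V) (hW : IsSemialgebraicFunOn ℚ T W)
    (hV0 : ∀ b ∈ T, 0 < V b) (hW0 : ∀ b ∈ T, 0 < W b) (hW1 : ∀ b ∈ T, W b < 1)
    (hVd : ∀ b ∈ T, DifferentiableAt ℝ V b)
    (RVW RV RW : IntegralRep (m + 1))
    (hVWd : RVW.domain = logUnfoldDomain T (fun b => V b * W b))
    (hVWi : EqOn RVW.integrand (logUnfoldIntegrand G) RVW.domain)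
    (hVd' : RV.domain = logUnfoldDomain T V) (hVi : EqOn RV.integrand (logUnfoldIntegrand G) RV.domain)
    (hWd : RW.domain = logUnfoldDomain T W) (hWi : EqOn RW.integrand (logUnfoldIntegrand G) RW.domain) :
    of RVW - of RV - of RW ∈ S := by
  have hc1 : IsSemialgebraicFunOn ℚ T (fun _ => (1 : ℝ)) := by simpa using isSemialgebraicFunOn_ratCast hT 1
  have hVW : IsSemialgebraicFunOn ℚ T (fun b => V b * W b) := IsSemialgebraicFunOn.mul_holds hV hW
  -- the dilated image of the negative sheet `RW = [(W, 1), −G/u]`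
  obtain ⟨RD, hDd, hDi, hrelD⟩ := exists_dilate_oband hS (p := W) (q := fun _ => (1 : ℝ)) (-1) hT hG hV hW hc1
    hV0 hVd hW0 (fun b hb => (hW1 b hb).le) RW (by rw [hWd, logUnfoldDomain_eq_of_le_one (fun b hb => (hW1 b hb).le)])
    (fun z hz => by
      have hz' := hz
      rw [hWd, logUnfoldDomain_eq_of_le_one (fun b hb => (hW1 b hb).le)] at hz'
      have h2 : ¬ (1 : ℝ) < z (Fin.last m) := not_lt.2 (le_of_lt hz'.2.2)
      rw [hWi hz, logUnfoldIntegrand, if_neg h2]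
      push_cast
      ring)
  -- Chasles for `VW ≤ V`, with the band `RD.neg = [(VW, V), G/u]`
  have hch := of_logUnfold_sub_sub_band_mem hS (G := G) (a := fun b => V b * W b) (b := V) hT hVW hV
    (fun b hb => mul_le_of_le_one_right (hV0 b hb).le (hW1 b hb).le) RV RVW RD.neg hVd' hVi hVWd hVWi
    (by rw [IntegralRep.domain_neg, hDd]; ext z; simp)
    (by
      rw [IntegralRep.integrand_neg, hDi]
      intro z _
      simp only [Pi.neg_apply]
      push_cast
      ring)
  have hcancel : of RD + of RD.neg ∈ S := of_add_of_neg_mem hS RD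
  have : of RVW - of RV - of RW = -(of RV - of RVW - of RD.neg) - (of RD + of RD.neg) - (of RW - of RD) := by
    abel
  rw [this]
  exact S.sub_mem (S.sub_mem (S.neg_mem hch) hcancel) hrelD

/-- **The product rule `log (V W) ~ log V + log W` for signed unfoldings, inside `S`.** For
`V, W > 0` `ℚ`-semialgebraic on the `ℚ`-semialgebraic base `T`, `V` differentiable at the points of
`T`, and representations `RVW`, `RV`, `RW` with the signed unfolding domains of `log (VW)`, `log V`,
`log W` over `T` and the signed unfolding integrand `±G/u`: `[RVW] − [RV] − [RW] ∈ S` (split the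
base into `{W ≥ 1}` and `{W < 1}`, rule 1a, and use the two halves). No factor needs to be `≥ 1`.
[Kontsevich–Zagier 2001, §1.1–1.2, rules 1)–2)] [folklore] -/
theorem of_logUnfold_prod_sub_sub_mem
    (hS : domainAddRel ∪ integrandAddRel ∪ changeOfVariablesRel ⊆ S)
    {T : Set (Fin m → ℝ)} {G V W : (Fin m → ℝ) → ℝ} (hT : IsSemialgebraic ℚ T)
    (hG : IsSemialgebraicFunOn ℚ T G) (hV : IsSemialgebraicFunOn ℚ T V) (hW : IsSemialgebraicFunOn ℚ T W)
    (hV0 : ∀ b ∈ T, 0 < V b) (hW0 : ∀ b ∈ T, 0 < W b) (hVd : ∀ b ∈ T, DifferentiableAt ℝ V b)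
    (RVW RV RW : IntegralRep (m + 1))
    (hVWd : RVW.domain = logUnfoldDomain T (fun b => V b * W b))
    (hVWi : EqOn RVW.integrand (logUnfoldIntegrand G) RVW.domain)
    (hVd' : RV.domain = logUnfoldDomain T V) (hVi : EqOn RV.integrand (logUnfoldIntegrand G) RV.domain)
    (hWd : RW.domain = logUnfoldDomain T W) (hWi : EqOn RW.integrand (logUnfoldIntegrand G) RW.domain) :
    of RVW - of RV - of RW ∈ S := by
  have hW1s : IsSemialgebraicFunOn ℚ T (fun b => W b - 1) :=
    (IsSemialgebraicFunOn.sub_holds hW (isSemialgebraicFunOn_ratCast hT 1)).congr fun b _ => by simp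
  set P : Set (Fin m → ℝ) := {b | b ∈ T ∧ 0 ≤ W b - 1} with hP_def
  have hP : IsSemialgebraic ℚ P := hW1s.isSemialgebraic_sep_nonneg
  have hTP : IsSemialgebraic ℚ (T ∩ P) := hT.inter hP
  have hTP' : IsSemialgebraic ℚ (T \ P) := hT.diff hP
  have hge : ∀ b ∈ T ∩ P, 1 ≤ W b := fun b hb => by have := hb.2.2; linarith
  have hlt : ∀ b ∈ T \ P, W b < 1 := fun b hb => by
    by_contra h
    exact hb.2 ⟨hb.1, by linarith [not_lt.1 h]⟩
  have sVW := of_sub_restrict_base_mem hS RVW hP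
  have sV := of_sub_restrict_base_mem hS RV hP
  have sW := of_sub_restrict_base_mem hS RW hP
  have h₁ := of_logUnfold_prod_sub_sub_mem_of_one_le hS (G := G) hTP
    (hG.mono inter_subset_left hTP) (hV.mono inter_subset_left hTP) (hW.mono inter_subset_left hTP)
    (fun b hb => hV0 b hb.1) hge (fun b hb => hVd b hb.1)
    (RVW.restrict (RVW.domain ∩ {z | Fin.init z ∈ P})
      (RVW.isSemialgebraic_domain.inter (isSemialgebraic_cyl hP)) inter_subset_left)
    (RV.restrict (RV.domain ∩ {z | Fin.init z ∈ P})
      (RV.isSemialgebraic_domain.inter (isSemialgebraic_cyl hP)) inter_subset_left)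
    (RW.restrict (RW.domain ∩ {z | Fin.init z ∈ P})
      (RW.isSemialgebraic_domain.inter (isSemialgebraic_cyl hP)) inter_subset_left)
    (by rw [IntegralRep.domain_restrict, hVWd, logUnfoldDomain_inter_cyl])
    (fun z hz => hVWi hz.1)
    (by rw [IntegralRep.domain_restrict, hVd', logUnfoldDomain_inter_cyl])
    (fun z hz => hVi hz.1)
    (by rw [IntegralRep.domain_restrict, hWd, logUnfoldDomain_inter_cyl])
    (fun z hz => hWi hz.1)
  have h₂ := of_logUnfold_prod_sub_sub_mem_of_lt_one hS (G := G) hTP'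
    (hG.mono sdiff_subset hTP') (hV.mono sdiff_subset hTP') (hW.mono sdiff_subset hTP')
    (fun b hb => hV0 b hb.1) (fun b hb => hW0 b hb.1) hlt (fun b hb => hVd b hb.1)
    (RVW.restrict (RVW.domain \ {z | Fin.init z ∈ P})
      (RVW.isSemialgebraic_domain.diff (isSemialgebraic_cyl hP)) sdiff_subset)
    (RV.restrict (RV.domain \ {z | Fin.init z ∈ P})
      (RV.isSemialgebraic_domain.diff (isSemialgebraic_cyl hP)) sdiff_subset)
    (RW.restrict (RW.domain \ {z | Fin.init z ∈ P})
      (RW.isSemialgebraic_domain.diff (isSemialgebraic_cyl hP)) sdiff_subset)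
    (by rw [IntegralRep.domain_restrict, hVWd, logUnfoldDomain_diff_cyl])
    (fun z hz => hVWi hz.1)
    (by rw [IntegralRep.domain_restrict, hVd', logUnfoldDomain_diff_cyl])
    (fun z hz => hVi hz.1)
    (by rw [IntegralRep.domain_restrict, hWd, logUnfoldDomain_diff_cyl])
    (fun z hz => hWi hz.1)
  set a₁ := of (RVW.restrict (RVW.domain ∩ {z | Fin.init z ∈ P})
      (RVW.isSemialgebraic_domain.inter (isSemialgebraic_cyl hP)) inter_subset_left)
  set a₂ := of (RVW.restrict (RVW.domain \ {z | Fin.init z ∈ P})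
      (RVW.isSemialgebraic_domain.diff (isSemialgebraic_cyl hP)) sdiff_subset)
  set b₁ := of (RV.restrict (RV.domain ∩ {z | Fin.init z ∈ P})
      (RV.isSemialgebraic_domain.inter (isSemialgebraic_cyl hP)) inter_subset_left)
  set b₂ := of (RV.restrict (RV.domain \ {z | Fin.init z ∈ P})
      (RV.isSemialgebraic_domain.diff (isSemialgebraic_cyl hP)) sdiff_subset)
  set c₁ := of (RW.restrict (RW.domain ∩ {z | Fin.init z ∈ P})
      (RW.isSemialgebraic_domain.inter (isSemialgebraic_cyl hP)) inter_subset_left)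
  set c₂ := of (RW.restrict (RW.domain \ {z | Fin.init z ∈ P})
      (RW.isSemialgebraic_domain.diff (isSemialgebraic_cyl hP)) sdiff_subset)
  have : of RVW - of RV - of RW = (of RVW - a₁ - a₂) - (of RV - b₁ - b₂) - (of RW - c₁ - c₂) +
      (a₁ - b₁ - c₁) + (a₂ - b₂ - c₂) := by abel
  rw [this]
  exact S.add_mem (S.add_mem (S.sub_mem (S.sub_mem sVW sV) sW) h₁) h₂

end Summit.KontsevichZagierPeriods.KontsevichZagierPeriods.Theorems
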